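import Summits.HubbardSuperconductivity.HubbardSuperconductivity.Theorems.NodalWardXYDefs
import Summits.HubbardSuperconductivity.HubbardSuperconductivity.Theorems.NodalWardXYPerturbedXYOrderEntire
import Summits.HubbardSuperconductivity.HubbardSuperconductivity.Theorems.NodalWardXYPerturbedXYOrderReduction

/-!
# `PerturbedXYOrder` (stmt-HubbardSuperconductivity-10739) — line `schwarz-inheritance`, stub `stub_smallVolumeStability`

Small volumes are free at every coupling `J`: if `9 ε L⁶ ≤ 1` then every kernel `K` admissible at radius `ε`
has `‖W_K(θ)‖ ≤ Σ_{b,b'} ‖K(b,b')‖ ≤ ε (3L³)² ≤ 1` pointwise, hence `Re (w_J e^{W_K}) ≥ ‖w_J e^{W_K}‖ / 2`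
(`cos x ≥ 1 - x²/2 ≥ 1/2` for `|x| ≤ 1`).  Integrating over the cube, `‖Z_K‖ ≥ Re Z_K ≥ ½ ∫ ‖w_J e^{W_K}‖ > 0`
and `‖num_K‖ ≤ L⁶ ∫ ‖w_J e^{W_K}‖`, so `Z_K ≠ 0` and `‖num_K / Z_K / L⁶‖ ≤ 2`.
-/

noncomputable section

namespace Summit.HubbardSuperconductivity.HubbardSuperconductivity.Theorems.PerturbedXYOrder

open MeasureTheory Literature.Probability.LatticeModels
open Summit.HubbardSuperconductivity.HubbardSuperconductivity.Theses.NodalWardXY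

variable {L : ℕ}

/-- Admissibility at radius `ε` gives the crude entrywise bound `‖K(b,b')‖ ≤ ε` (and forces `0 ≤ ε`). -/
theorem sv_norm_le_of_admissible [NeZero L] {ε : ℝ} {K : Bond L → Bond L → ℂ} (hK : Admissible L ε K)
    (b b' : Bond L) : ‖K b b'‖ ≤ ε := by
  have h := hK b b'
  have h1 : (1:ℝ) ≤ 1 + ((torusGraph 3 L).dist b.1 b'.1 : ℝ) := le_add_of_nonneg_right (Nat.cast_nonneg _)
  have hd : (1:ℝ) ≤ (1 + ((torusGraph 3 L).dist b.1 b'.1 : ℝ)) ^ 4 := one_le_pow₀ h1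
  have hpos : (0:ℝ) < (1 + ((torusGraph 3 L).dist b.1 b'.1 : ℝ)) ^ 4 := by positivity
  have hε : 0 ≤ ε := by
    by_contra hneg
    have : ε / (1 + ((torusGraph 3 L).dist b.1 b'.1 : ℝ)) ^ 4 < 0 := div_neg_of_neg_of_pos (not_le.1 hneg) hpos
    linarith [norm_nonneg (K b b')]
  exact h.trans (div_le_self hε hd)

/-- On small volumes the perturbation is uniformly small: `‖W_K(θ)‖ ≤ 9 ε L⁶ ≤ 1`. -/
theorem sv_norm_Wk_le_one [NeZero L] {ε : ℝ} (hεL : 9 * ε * (L : ℝ) ^ 6 ≤ 1) {K : Bond L → Bond L → ℂ}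
    (hK : Admissible L ε K) (θ : TorusSite 3 L → ℝ) : ‖Wk K θ‖ ≤ 1 := by
  calc ‖Wk K θ‖ ≤ ∑ b : Bond L, ∑ b' : Bond L, ‖K b b'‖ := ent_norm_Wk_le K θ
    _ ≤ ∑ _b : Bond L, ∑ _b' : Bond L, ε := by
        gcongr with b _ b' _
        exact sv_norm_le_of_admissible hK b b'
    _ = 9 * ε * (L : ℝ) ^ 6 := by
        simp only [Finset.sum_const, Finset.card_univ, nsmul_eq_mul, Fintype.card_prod, Fintype.card_fun,
          Fintype.card_fin, ZMod.card]
        push_cast; ring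
    _ ≤ 1 := hεL

/-- `cos x ≥ 1/2` for `|x| ≤ 1` (from `1 - x²/2 ≤ cos x`). -/
theorem sv_half_le_cos {x : ℝ} (hx : |x| ≤ 1) : (1:ℝ) / 2 ≤ Real.cos x := by
  have h := Real.one_sub_sq_div_two_le_cos (x := x)
  have hx2 : x ^ 2 ≤ 1 := by
    have h' := abs_le.1 hx
    nlinarith
  linarith

/-- Pointwise sector estimate: for `0 ≤ r` and `‖W‖ ≤ 1`, `‖r e^{W}‖ ≤ 2 Re (r e^{W})`. -/
theorem sv_norm_le_two_mul_re {r : ℝ} (hr : 0 ≤ r) {W : ℂ} (hW : ‖W‖ ≤ 1) :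
    ‖(r : ℂ) * Complex.exp W‖ ≤ 2 * ((r : ℂ) * Complex.exp W).re := by
  rw [norm_mul, Complex.norm_real, Real.norm_eq_abs, abs_of_nonneg hr, Complex.norm_exp,
    Complex.re_ofReal_mul, Complex.exp_re]
  have hcos : (1:ℝ) / 2 ≤ Real.cos W.im := sv_half_le_cos ((Complex.abs_im_le_norm W).trans hW)
  have hre : 0 ≤ r * Real.exp W.re := mul_nonneg hr (Real.exp_pos _).le
  have key : 0 ≤ r * Real.exp W.re * (2 * Real.cos W.im - 1) := mul_nonneg hre (by linarith)
  nlinarith [key]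

/-- The perturbed Gibbs integrand `w_J e^{W_K}` is continuous. -/
theorem sv_continuous_integrand [NeZero L] (J : ℝ) (K : Bond L → Bond L → ℂ) :
    Continuous fun θ : TorusSite 3 L → ℝ => wJ J θ * Complex.exp (Wk K θ) :=
  (ent_continuous_wJ J).mul (Complex.continuous_exp.comp (ent_continuous_Wk K))

/-- The perturbed Gibbs integrand is integrable on the cube. -/
theorem sv_integrable_integrand [NeZero L] (J : ℝ) (K : Bond L → Bond L → ℂ) :
    Integrable (fun θ : TorusSite 3 L → ℝ => wJ J θ * Complex.exp (Wk K θ)) (volume.restrict (cube L)) :=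
  (sv_continuous_integrand J K).continuousOn.integrableOn_compact ent_isCompact_cube

/-- The perturbed Gibbs integrand never vanishes: `0 < ‖w_J e^{W_K}‖`. -/
theorem sv_norm_integrand_pos [NeZero L] (J : ℝ) (K : Bond L → Bond L → ℂ) (θ : TorusSite 3 L → ℝ) :
    0 < ‖wJ J θ * Complex.exp (Wk K θ)‖ := by
  rw [norm_mul, Complex.norm_exp]
  refine mul_pos ?_ (Real.exp_pos _)
  unfold wJ
  rw [Complex.norm_real, Real.norm_eq_abs, Real.abs_exp]
  exact Real.exp_pos _

/-- `∫_cube ‖w_J e^{W_K}‖ > 0`. -/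
theorem sv_integral_norm_pos [NeZero L] (J : ℝ) (K : Bond L → Bond L → ℂ) :
    0 < ∫ θ in cube L, ‖wJ J θ * Complex.exp (Wk K θ)‖ := by
  have hni : IntegrableOn (fun θ : TorusSite 3 L → ℝ => ‖wJ J θ * Complex.exp (Wk K θ)‖) (cube L) volume :=
    (sv_integrable_integrand J K).norm
  rw [integral_pos_iff_support_of_nonneg (fun θ => norm_nonneg _) hni]
  have hsupp : Function.support (fun θ : TorusSite 3 L → ℝ => ‖wJ J θ * Complex.exp (Wk K θ)‖) = Set.univ :=
    Set.eq_univ_of_forall fun θ => (sv_norm_integrand_pos J K θ).ne'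
  rw [hsupp, Measure.restrict_apply_univ]
  exact volume_cube_pos

/-- Small volumes: `∫_cube ‖w_J e^{W_K}‖ ≤ 2 ‖Z_K‖` (via `Re Z_K = ∫ Re (w_J e^{W_K}) ≥ ½ ∫ ‖w_J e^{W_K}‖`). -/
theorem sv_integral_norm_le_two_mul_norm_Zk [NeZero L] {ε : ℝ} (hεL : 9 * ε * (L : ℝ) ^ 6 ≤ 1) (J : ℝ)
    {K : Bond L → Bond L → ℂ} (hK : Admissible L ε K) :
    ∫ θ in cube L, ‖wJ J θ * Complex.exp (Wk K θ)‖ ≤ 2 * ‖Zk J K‖ := by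
  have hfi := sv_integrable_integrand J K
  have hpt : ∀ θ : TorusSite 3 L → ℝ, ‖wJ J θ * Complex.exp (Wk K θ)‖ ≤ 2 * (wJ J θ * Complex.exp (Wk K θ)).re :=
    fun θ => by
      unfold wJ
      exact sv_norm_le_two_mul_re (Real.exp_pos _).le (sv_norm_Wk_le_one hεL hK θ)
  have hrei : Integrable (fun θ : TorusSite 3 L → ℝ => 2 * (wJ J θ * Complex.exp (Wk K θ)).re)
      (volume.restrict (cube L)) :=
    ((Complex.continuous_re.comp (sv_continuous_integrand J K)).continuousOn.integrableOn_compact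
      ent_isCompact_cube).const_mul 2
  have hre : ∫ θ in cube L, (wJ J θ * Complex.exp (Wk K θ)).re = (Zk J K).re := by
    have h := integral_re hfi
    simp only [RCLike.re_to_complex] at h
    exact h
  calc ∫ θ in cube L, ‖wJ J θ * Complex.exp (Wk K θ)‖
      ≤ ∫ θ in cube L, 2 * (wJ J θ * Complex.exp (Wk K θ)).re := integral_mono hfi.norm hrei hpt
    _ = 2 * (Zk J K).re := by rw [integral_const_mul, hre]
    _ ≤ 2 * ‖Zk J K‖ := by gcongr; exact Complex.re_le_norm _

/-- `‖num_K‖ ≤ L⁶ ∫_cube ‖w_J e^{W_K}‖` (`|cos| ≤ 1`, `L⁶` pairs of sites). -/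
theorem sv_norm_num_le [NeZero L] (J : ℝ) (K : Bond L → Bond L → ℂ) :
    ‖num J K‖ ≤ (L : ℝ) ^ 6 * ∫ θ in cube L, ‖wJ J θ * Complex.exp (Wk K θ)‖ := by
  have hni : Integrable (fun θ : TorusSite 3 L → ℝ => ‖wJ J θ * Complex.exp (Wk K θ)‖) (volume.restrict (cube L)) :=
    (sv_integrable_integrand J K).norm
  have hterm : ∀ x y : TorusSite 3 L,
      ‖∫ θ in cube L, (Real.cos (θ x - θ y) : ℂ) * (wJ J θ * Complex.exp (Wk K θ))‖ ≤
        ∫ θ in cube L, ‖wJ J θ * Complex.exp (Wk K θ)‖ := by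
    intro x y
    calc ‖∫ θ in cube L, (Real.cos (θ x - θ y) : ℂ) * (wJ J θ * Complex.exp (Wk K θ))‖
        ≤ ∫ θ in cube L, ‖(Real.cos (θ x - θ y) : ℂ) * (wJ J θ * Complex.exp (Wk K θ))‖ :=
          norm_integral_le_integral_norm _
      _ ≤ ∫ θ in cube L, ‖wJ J θ * Complex.exp (Wk K θ)‖ := by
          refine integral_mono_of_nonneg (ae_of_all _ fun θ => norm_nonneg _) hni (ae_of_all _ fun θ => ?_)
          show ‖(Real.cos (θ x - θ y) : ℂ) * (wJ J θ * Complex.exp (Wk K θ))‖ ≤ ‖wJ J θ * Complex.exp (Wk K θ)‖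
          rw [norm_mul, Complex.norm_real, Real.norm_eq_abs]
          exact mul_le_of_le_one_left (norm_nonneg _) (Real.abs_cos_le_one _)
  unfold num
  calc ‖∑ x : TorusSite 3 L, ∑ y : TorusSite 3 L,
          ∫ θ in cube L, (Real.cos (θ x - θ y) : ℂ) * (wJ J θ * Complex.exp (Wk K θ))‖
      ≤ ∑ x : TorusSite 3 L, ‖∑ y : TorusSite 3 L,
          ∫ θ in cube L, (Real.cos (θ x - θ y) : ℂ) * (wJ J θ * Complex.exp (Wk K θ))‖ := norm_sum_le _ _
    _ ≤ ∑ x : TorusSite 3 L, ∑ y : TorusSite 3 L,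
          ‖∫ θ in cube L, (Real.cos (θ x - θ y) : ℂ) * (wJ J θ * Complex.exp (Wk K θ))‖ :=
        Finset.sum_le_sum fun x _ => norm_sum_le _ _
    _ ≤ ∑ _x : TorusSite 3 L, ∑ _y : TorusSite 3 L, ∫ θ in cube L, ‖wJ J θ * Complex.exp (Wk K θ)‖ := by
        gcongr with x _ y _; exact hterm x y
    _ = (L : ℝ) ^ 6 * ∫ θ in cube L, ‖wJ J θ * Complex.exp (Wk K θ)‖ := by
        simp only [Finset.sum_const, Finset.card_univ, nsmul_eq_mul, Fintype.card_fun, Fintype.card_fin, ZMod.card]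
        push_cast; ring

/-- **Small volumes are free at every coupling.** If `9 ε L⁶ ≤ 1` then for every `J` and every kernel `K`
admissible at radius `ε` on the torus `(ℤ/Lℤ)³`, the perturbed partition function does not vanish and the complex
plateau is bounded by `2`: `‖W_K‖ ≤ 1` pointwise, so `Re (w_J e^{W_K}) ≥ ½ ‖w_J e^{W_K}‖`, whence
`‖Z_K‖ ≥ ½ ∫ ‖w_J e^{W_K}‖ > 0` and `‖num_K‖ ≤ L⁶ ∫ ‖w_J e^{W_K}‖`. -/
theorem stub_smallVolumeStability : ∀ (L : ℕ) [NeZero L] (ε : ℝ), 9 * ε * (L : ℝ) ^ 6 ≤ 1 →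
    ∀ (J : ℝ) (K : Bond L → Bond L → ℂ), Admissible L ε K → Zk J K ≠ 0 ∧ ‖cratio L J K‖ ≤ 2 := by
  intro L _ ε hεL J K hK
  have hIpos := sv_integral_norm_pos (L := L) J K
  have hIle := sv_integral_norm_le_two_mul_norm_Zk hεL J hK
  have hnum := sv_norm_num_le (L := L) J K
  have hZpos : 0 < ‖Zk J K‖ := by linarith
  have hZne : Zk J K ≠ 0 := norm_pos_iff.1 hZpos
  refine ⟨hZne, ?_⟩
  have hL : (0:ℝ) < (L : ℝ) ^ 6 := by
    have := NeZero.pos L; positivity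
  unfold cratio
  rw [norm_div, norm_div]
  have hL' : ‖((L : ℂ)) ^ 6‖ = (L : ℝ) ^ 6 := by simp
  rw [hL', div_div, div_le_iff₀ (by positivity)]
  calc ‖num J K‖ ≤ (L : ℝ) ^ 6 * ∫ θ in cube L, ‖wJ J θ * Complex.exp (Wk K θ)‖ := hnum
    _ ≤ (L : ℝ) ^ 6 * (2 * ‖Zk J K‖) := by gcongr
    _ = 2 * (‖Zk J K‖ * (L : ℝ) ^ 6) := by ring

end Summit.HubbardSuperconductivity.HubbardSuperconductivity.Theorems.PerturbedXYOrder

end
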